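import Literature.NumberTheory.EllipticCurves.OggFormulaPotGoodOrdinaryTwoProofs
import Literature.NumberTheory.EllipticCurves.ComplexMultiplicationDeuringRamified1728Proofs
import Literature.NumberTheory.DiophantineGeometry.TateAlgorithmEvalProofs
import HarnessLib

/-!
# Ogg's formula at `2` for `j = 1728`: the discriminant side (`y² = x³ + ax` over `ℚ`)

`Proofs` file (theorems only, no definitions, no named facts) in topic
`NumberTheory/EllipticCurves`, landed by seat B of the C15 fact
`WeierstrassCurve.conductorNatOf_geomPoints_eq_conductorNorm_of_isElliptic` (`HasseWeilAbelian`),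
sequel of `HasseWeilAbelianConductorNatOfPotGoodTwoProofs` (same seat) and of
`OggFormulaPotGoodOrdinaryTwoProofs` (seat of bsd.S15).  After those files the three conductor
facts over `ℚ` (C15, the exponent fact of `HasseWeilAbelian`, bsd.S15) are all reduced to Saito's
half of Ogg's formula at `2` for the additive curves `E/ℚ` with `ord₂(j) > 0` (supersingular
potential good reduction), in the form *`Sw_𝔓(E[3]) = δ₂(E) := f₂ - 2 = ord₂ Δ_min - 1 - m₂` for
one prime `𝔓 ∣ 2`* (`…_of_valuation_j_lt_one`).  Two CM families lie in that case: `j = 0`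
(`y² = x³ + k`, settled since in `OggFormulaJZeroTwoProofs` by the seat of bsd.S15) and
**`j = 1728`**: every elliptic `W/ℚ` with `j = 1728` is `y² = x³ + ax`, `a = 2^r a₀ ∈ ℤ`, `a₀` odd,
`r ∈ {0, 1, 2, 3}` (`exists_variableChange_eq_of_j_eq_1728`,
`ComplexMultiplicationDeuringRamified1728Proofs`), always additive at `2`
(`hasAdditiveReductionAt_two_mk_pow_mul_odd`) with `ord₂(j) = ord₂(1728) = 6 > 0`.

This file computes the **discriminant side** `δ₂` for `y² = x³ + ax` by Tate's algorithm
(Silverman *ATAEC* IV.9.4, read through the forward-evaluation theorems of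
`TateAlgorithmEvalProofs` and `TateAlgorithmIstarEvalProofs`), for all classes of `a`:

| `a`                        | model at `2`                     | type   | `ord₂ Δ_min` | `f₂` | `δ₂` |
|----------------------------|----------------------------------|--------|--------------|------|------|
| `a ≡ 1 (mod 4)`            | `y² = x³ + 3x² + (a+3)x + (a+1)` | `II`   | `6`          | `6`  | `4`  |
| `a ≡ 3 (mod 4)`            | same (`x ↦ x + 1`)               | `III`  | `6`          | `5`  | `3`  |
| `a = 2m`, `m` odd          | `y² = x³ + ax`                   | `III`  | `9`          | `8`  | `6`  |
| `a = 4m`, `m ≡ 3 (mod 4)`  | `y² = x³ + ax` (minimal: Kraus)  | `I₂*`  | `12`         | `6`  | `4`  |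
| `a = 4m`, `m ≡ 1 (mod 4)`  | `y² = x³ + ax` (minimal: Kraus)  | `I₃*`  | `12`         | `5`  | `3`  |
| `a = 8m`, `m` odd          | `y² = x³ + ax` (minimal: Kraus)  | `III*` | `15`         | `8`  | `6`  |

The values of `f₂` agree with Cremona's tables (`32a2: y² = x³ - x`, `64a4: y² = x³ + x`,
`256b1, 256c1: y² = x³ ∓ 2x`, `64a1: y² = x³ - 4x`, `32a1: y² = x³ + 4x`,
`256a1, 256d1: y² = x³ ∓ 8x`), as Ogg–Saito predicts; the theorems below of course only concern the
tree's `conductorExponent` (defined by Ogg's formula) and make no use of those tables.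

* `kodairaSymbolAt_and_ordMinimalDiscriminant_of_step2_model` — engine: types `II`/`III` read on
  a step-2 normalised `ℚ`-model at any finite place (`TateAlgorithmEvalProofs` on the `O_v`-model);
* `kodairaSymbolAt_and_ordMinimalDiscriminant_of_j1728_emod_four_eq_one / _eq_three /
  _two_mul_odd / _four_mul_odd / _eight_mul_odd` — the six rows (Kodaira symbol and `ord₂ Δ_min` of
  `W` at the place above `2`, for `C • W = ⟨0, 0, 0, a, 0⟩`);
* `wildConductorExponent_of_j1728_emod_four_eq_one / …`, `wildConductorExponent_of_j1728_class`,
  `exists_j1728_model_wildConductorExponent` — `δ₂ = 4, 3, 6, 4 | 3, 6`, and every elliptic `W/ℚ`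
  with `j = 1728` is in one of the six classes;
* `swanConductorAt_rationalTate_eq_wildConductorExponent_of_ringChar_eq_two_of_j1728_model`,
  `conductorNatOf_geomPoints_eq_conductorNorm_of_isElliptic_of_j1728_model` — consequently, for
  such a `W`, Saito's half of Ogg's formula at `2` (every `ℓ`) and the C15 fact follow from the one
  Galois-side statement *`Sw_𝔓(E[3]) = δ₂` (`= 4, 3, 6, 4 | 3, 6` by class) for some prime `𝔓 ∣ 2`
  of `\bar ℤ`*.

What that Galois-side statement requires (not in the tree): for `E = E_a`, `L = ℚ₂^{nr}(E[3])` has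
`Gal(L/ℚ₂^{nr}) ≅ Q₈` for every `a` (the field of `x`-coordinates `ℚ₂^{nr}(x)`,
`3x⁴ + 6ax² - a² = 0`, is biquadratic, `= ℚ₂^{nr}(i, √(a√-3))`, and `V₄ ⊄ SL₂(𝔽₃)`), so that
`Sw(E[3]) = 2u_L` with `u_L = δ₂/2 ∈ {3/2, 2, 3}` the highest upper ramification break of
`L/ℚ₂^{nr}`: a quaternion break computation (lower break `2δ₂ - 5 ∈ {1, 3, 7}` for `4 ∤ a`, resp.
the analogous values for `a = 4m, 8m`, of the quadratic layer `L/ℚ₂^{nr}(x)` of ramification index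
`4`, then Herbrand).  The tree's route to it is now `ThreeTorsionWildInertiaRootsProofs`
(`card_mul_swanConductorAt_torsion_eq_of_roots`: for quaternion wild inertia, `#Q₀ · Sw_𝔓(E[3])` from
six valuations of explicit elements of `ℚ(x(E[3]))` and `ℚ(E[3])`, worked out in a docstring there
for `y² = x³ - x`: `Sw = 3`), with the radicals of `ThreeTorsionRadical(s)Proofs`; the rows of this
file are the `Q₈` rows `δ₂ = 3 ↔ (III, 6), (I₃*, 12)`, `δ₂ = 4 ↔ (II, 6), (I₂*, 12)`,
`δ₂ = 6 ↔ (III, 9), (III*, 15)` of the numerical atlas of `ThreeTorsionRadicalsNormProofs`.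
Unramified twists `a ↦ 9a` and the `2`-isogeny `a ↦ -4a` preserve `Sw`.

## References

* J. H. Silverman, *Advanced Topics in the Arithmetic of Elliptic Curves*, GTM 151 (1994), IV.9.4
  (Tate's algorithm, Steps 1–9, PDF pp. 344–346) and Table 4.1; §IV.10 (definition of
  `ε, δ, f`, PDF p. 358; of the conductor, p. 364); §IV.11 (Ogg's formula 11.1, p. 365; `p = 2`,
  p. 366). [SilvermanATAEC1994]
* J. H. Silverman, *The Arithmetic of Elliptic Curves*, 2nd ed. (2009), VII.1 Remark 1.1
  (`ord Δ < 12` gives minimality), X.5.4 (twists of `j = 1728`). [SilvermanAEC2009]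
* A. Kraus, *Quelques remarques à propos des invariants c₄, c₆ et Δ d'une courbe elliptique*,
  Acta Arith. 54 (1989), Prop. 2 (minimality at `2`). [Kraus1989]
* J.-P. Serre, J. Tate, *Good reduction of abelian varieties*, Ann. of Math. 88 (1968), §3.
  [SerreTate1968]
* T. Saito, *Conductor, discriminant, and the Noether formula of arithmetic surfaces*, Duke Math.
  J. 57 (1988), Theorem 1 (cited only). [Saito1988]

## Design

Theorems only; `noncomputable section`; namespace `WeierstrassCurve` (dot-notation companions of
the sibling files, deliberate extensions of the Mathlib namespace).  The place is any `v` with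
`natGenerator v = 2` for the Kodaira statements and `primesEquiv.symm 2` in the assembly; the
models over `O_v = ℤ₂` for the `Iₙ*` sub-procedure are `C • I` for explicit translations `C` of the
integral model `I`, their coefficients' orders being read in `ℚ` through `O_v → ℚ₂`; the
`ℤ/3`-module structure on `E[3]` is Mathlib's `AddSubgroup.torsionBy.zmodModule`, activated per
theorem as in the sibling files.  Axioms: `propext`, `Classical.choice`, `Quot.sound`.
-/

noncomputable section

open scoped Classical NumberField
open IsDedekindDomain Field Rat.HeightOneSpectrum Literature.NumberTheory.EllipticCurves
  Literature.NumberTheory.GaloisRepresentations Literature.NumberTheory.DiophantineGeometry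
  Literature.NumberTheory.DiophantineGeometry.TateAlgorithm

namespace WeierstrassCurve

/-! ### `2`-adic bookkeeping -/

section TwoAdic

variable (v : HeightOneSpectrum (𝓞 ℚ))

/-- `|2ᵏ m|_v = exp(-k)` at the place above `2` for `m` odd. [folklore] -/
private theorem valuation_two_pow_mul_of_odd (hv : natGenerator v = 2) (k : ℕ) {m : ℤ}
    (hm : ¬ (2 : ℤ) ∣ m) : v.valuation ℚ ((2 : ℚ) ^ k * m) = WithZero.exp (-(k : ℤ)) := by
  have h2 : v.valuation ℚ (2 : ℚ) = WithZero.exp (-1 : ℤ) := by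
    have := Rat.valuation_natGenerator v; rwa [hv, Nat.cast_ofNat] at this
  rw [map_mul, map_pow, h2, Rat.valuation_intCast_eq_one v (by rw [hv]; exact_mod_cast hm), mul_one,
    ← WithZero.exp_nsmul]
  simp

/-- `|n|_v ≤ exp(-e)` at the place above `2` when `2ᵉ ∣ n`. [folklore] -/
private theorem valuation_le_of_two_pow_dvd (hv : natGenerator v = 2) {n : ℤ} {e : ℕ}
    (h : (2 : ℤ) ^ e ∣ n) : v.valuation ℚ (n : ℚ) ≤ WithZero.exp (-(e : ℤ)) :=
  Rat.valuation_intCast_le v (by rw [hv]; exact_mod_cast h)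

/-- An element of `O_v` of valuation exactly `exp(-n)` is not divisible by `ϖⁿ⁺¹`. [folklore] -/
private theorem not_pow_succ_dvd_of_valued_eq {x : v.adicCompletionIntegers ℚ} {n : ℕ}
    (h : Valued.v (x : v.adicCompletion ℚ) = WithZero.exp (-(n : ℤ))) :
    ¬ uniformizer (v.adicCompletionIntegers ℚ) ^ (n + 1) ∣ x := by
  have hϖ : Irreducible (uniformizer (v.adicCompletionIntegers ℚ)) := irreducible_uniformizer
  obtain ⟨u, hu, hx⟩ := exists_isUnit_eq_uniformizer_pow_mul_of_valued_eq v h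
  rintro ⟨c, hc⟩
  rw [hx, pow_succ, mul_assoc] at hc
  have hc' : u = uniformizer (v.adicCompletionIntegers ℚ) * c :=
    mul_left_cancel₀ (pow_ne_zero n hϖ.ne_zero) hc
  exact hϖ.not_isUnit (isUnit_of_mul_isUnit_left (hc' ▸ hu))

end TwoAdic

/-! ### Tate's algorithm on `y² = x³ + ax` at `2` -/

section Kodaira

variable (v : HeightOneSpectrum (𝓞 ℚ)) (W : WeierstrassCurve ℚ)

/-- **Engine: types `II` / `III` read on a step-2 normalised `ℚ`-model at a finite place `v`.**
Let `M = D • W` be a `ℚ`-model of the elliptic curve `W` whose coefficients are `v`-integral, with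
`ord_v Δ(M) = n ∈ [1, 12)` (so `M` is minimal at `v`, *AEC* VII.1.1) and `ϖ ∣ a₃, a₄, a₆, b₂`
(the singular point of the reduction is `(0,0)`).  If `ord_v a₆ = 1` then `W` has Kodaira type
`II` at `v`; if `ϖ² ∣ a₆` and `ord_v b₈ = k < 3` then type `III`; in both cases `ord_v Δ_min = n`
(`kodairaSymbolOfMinimal_eq_II_of_step2`, `…_III_of_step2` of `TateAlgorithmEvalProofs` on the
`O_v`-model, `kodairaSymbolAt_eq_kodairaSymbolOfMinimal_of_isMinimal`).
[cite: SilvermanATAEC1994, IV.9.4 Steps 1–4 (PDF pp. 344–345)] [cite: SilvermanAEC2009, VII.1 Remark 1.1] -/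
theorem kodairaSymbolAt_and_ordMinimalDiscriminant_of_step2_model [W.IsElliptic]
    (M : WeierstrassCurve ℚ) (D : VariableChange ℚ) (hM : M = D • W)
    (h₁ : v.valuation ℚ M.a₁ ≤ 1) (h₂ : v.valuation ℚ M.a₂ ≤ 1)
    (h₃ : v.valuation ℚ M.a₃ ≤ WithZero.exp (-1 : ℤ))
    (h₄ : v.valuation ℚ M.a₄ ≤ WithZero.exp (-1 : ℤ))
    (h₆ : v.valuation ℚ M.a₆ ≤ WithZero.exp (-1 : ℤ))
    (hb₂ : v.valuation ℚ M.b₂ ≤ WithZero.exp (-1 : ℤ))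
    {n : ℕ} (hn1 : 1 ≤ n) (hn : n < 12) (hΔ : v.valuation ℚ M.Δ = WithZero.exp (-(n : ℤ)))
    {T : KodairaSymbol}
    (hexit : (v.valuation ℚ M.a₆ = WithZero.exp (-((1 : ℕ) : ℤ)) ∧ T = .II) ∨
      (v.valuation ℚ M.a₆ ≤ WithZero.exp (-2 : ℤ) ∧
        (∃ k : ℕ, k < 3 ∧ v.valuation ℚ M.b₈ = WithZero.exp (-(k : ℤ))) ∧ T = .III)) :
    W.kodairaSymbolAt v = T ∧ W.ordMinimalDiscriminant v = n := by
  haveI := perfectField_residueField_adicCompletionIntegers (K := ℚ) v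
  haveI hMell : M.IsElliptic := by rw [hM]; infer_instance
  have hexp1 : WithZero.exp (-1 : ℤ) ≤ (1 : WithZero (Multiplicative ℤ)) := by
    rw [← WithZero.exp_zero, WithZero.exp_le_exp]; omega
  -- integrality and minimality of `X = M ⊗ ℚ_v`
  have hint : M.IsIntegralAt v :=
    M.isIntegralAt_of_valuation_le_one v h₁ h₂ (h₃.trans hexp1) (h₄.trans hexp1) (h₆.trans hexp1)
  have hmin : M.IsMinimalAt v :=
    isMinimalAt_of_lt_valuation_Δ_holds hint (by rw [hΔ]; exact WithZero.exp_lt_exp.mpr (by omega))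
  set X := M.baseChange (v.adicCompletion ℚ) with hX
  haveI hXint : X.IsIntegral (v.adicCompletionIntegers ℚ) := hint
  haveI hXmin : X.IsMinimal (v.adicCompletionIntegers ℚ) := hmin
  haveI hXell : X.IsElliptic := by rw [hX, WeierstrassCurve.baseChange]; infer_instance
  set I := X.integralModel (v.adicCompletionIntegers ℚ) with hI
  -- valuations of the coefficients of the `O_v`-model
  have hva : ∀ (x : v.adicCompletionIntegers ℚ) (q : ℚ),
      algebraMap (v.adicCompletionIntegers ℚ) (v.adicCompletion ℚ) x =
        algebraMap ℚ (v.adicCompletion ℚ) q →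
      Valued.v (x : v.adicCompletion ℚ) = v.valuation ℚ q := by
    intro x q h
    rw [show (x : v.adicCompletion ℚ) = algebraMap _ (v.adicCompletion ℚ) x from rfl, h,
      valued_algebraMap_adicCompletion]
  have hIa₃ : Valued.v ((I.a₃ : v.adicCompletionIntegers ℚ) : v.adicCompletion ℚ) =
      v.valuation ℚ M.a₃ :=
    hva _ _ (by rw [hI, integralModel_a₃_eq, hX, WeierstrassCurve.baseChange, map_a₃])
  have hIa₄ : Valued.v ((I.a₄ : v.adicCompletionIntegers ℚ) : v.adicCompletion ℚ) =
      v.valuation ℚ M.a₄ :=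
    hva _ _ (by rw [hI, integralModel_a₄_eq, hX, WeierstrassCurve.baseChange, map_a₄])
  have hIa₆ : Valued.v ((I.a₆ : v.adicCompletionIntegers ℚ) : v.adicCompletion ℚ) =
      v.valuation ℚ M.a₆ :=
    hva _ _ (by rw [hI, integralModel_a₆_eq, hX, WeierstrassCurve.baseChange, map_a₆])
  have hIb₂ : Valued.v ((I.b₂ : v.adicCompletionIntegers ℚ) : v.adicCompletion ℚ) =
      v.valuation ℚ M.b₂ :=
    hva _ _ (by rw [hI, integralModel_b₂_eq, hX, WeierstrassCurve.baseChange, map_b₂])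
  have hIb₈ : Valued.v ((I.b₈ : v.adicCompletionIntegers ℚ) : v.adicCompletion ℚ) =
      v.valuation ℚ M.b₈ :=
    hva _ _ (by rw [hI, integralModel_b₈_eq, hX, WeierstrassCurve.baseChange, map_b₈])
  have hIΔ : Valued.v ((I.Δ : v.adicCompletionIntegers ℚ) : v.adicCompletion ℚ) =
      WithZero.exp (-(n : ℤ)) := by
    rw [← hΔ]
    exact hva _ _ (by rw [hI, integralModel_Δ_eq, hX, WeierstrassCurve.baseChange, map_Δ])
  -- divisibilities on the `O_v`-model
  set ϖ := uniformizer (v.adicCompletionIntegers ℚ)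
  have dvd1 : ∀ {x : v.adicCompletionIntegers ℚ},
      Valued.v (x : v.adicCompletion ℚ) ≤ WithZero.exp (-1 : ℤ) → ϖ ∣ x := fun {x} hx ↦ by
    have := uniformizer_pow_dvd_of_valued_le v (x := x) (n := 1) (by exact_mod_cast hx)
    rwa [pow_one] at this
  have nΔ : ϖ ∣ I.Δ := dvd1 (by rw [hIΔ, WithZero.exp_le_exp]; omega)
  have n3 : ϖ ∣ I.a₃ := dvd1 (by rw [hIa₃]; exact h₃)
  have n4 : ϖ ∣ I.a₄ := dvd1 (by rw [hIa₄]; exact h₄)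
  have n6 : ϖ ∣ I.a₆ := dvd1 (by rw [hIa₆]; exact h₆)
  have nb₂ : ϖ ∣ I.b₂ := dvd1 (by rw [hIb₂]; exact hb₂)
  have hordΔ : (IsDiscreteValuationRing.addVal (v.adicCompletionIntegers ℚ) I.Δ).toNat = n :=
    addVal_toNat_eq_of_valued_eq v hIΔ
  -- Tate's algorithm
  have hK : I.kodairaSymbolOfMinimal = T := by
    rcases hexit with ⟨ha₆, rfl⟩ | ⟨ha₆, ⟨k, hk, hb₈⟩, rfl⟩
    · refine kodairaSymbolOfMinimal_eq_II_of_step2 nΔ n3 n4 n6 nb₂ ?_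
      exact not_pow_succ_dvd_of_valued_eq v (n := 1) (by rw [hIa₆, ha₆])
    · refine kodairaSymbolOfMinimal_eq_III_of_step2 nΔ n3 n4 n6 nb₂ ?_ ?_
      · exact uniformizer_pow_dvd_of_valued_le v (n := 2) (by rw [hIa₆]; exact_mod_cast ha₆)
      · intro h3
        exact not_pow_succ_dvd_of_valued_eq v (n := k) (by rw [hIb₈, hb₈])
          ((pow_dvd_pow ϖ (by omega : k + 1 ≤ 3)).trans h3)
  -- read `kodairaSymbolAt` and `ord Δ_min` of `W` on the minimal model `X`
  have hrel : X = (D.map (algebraMap ℚ (v.adicCompletion ℚ))) • W.baseChange (v.adicCompletion ℚ) := by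
    rw [hX, hM, WeierstrassCurve.baseChange, WeierstrassCurve.baseChange, map_variableChange]
  refine ⟨?_, ?_⟩
  · rw [W.kodairaSymbolAt_eq_kodairaSymbolOfMinimal_of_isMinimal v X _ hrel X.isUnit_Δ.ne_zero, ← hI,
      hK]
  · rw [W.ordMinimalDiscriminant_eq_of_isMinimal v X _ hrel X.isUnit_Δ.ne_zero, ← hI, hordΔ]

variable {v W}

/-- The translated model `x ↦ x + 1` of `y² = x³ + ax`: `y² = x³ + 3x² + (a + 3)x + (a + 1)`.
[folklore] -/
theorem smul_mk_a_eq_translate (a : ℚ) :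
    (⟨1, 1, 0, 0⟩ : VariableChange ℚ) • (⟨0, 0, 0, a, 0⟩ : WeierstrassCurve ℚ) =
      ⟨0, 3, 0, a + 3, a + 1⟩ := by
  ext <;> simp [variableChange_a₁, variableChange_a₂, variableChange_a₃, variableChange_a₄,
    variableChange_a₆]

/-- **`y² = x³ + ax`, `a ≡ 1 (mod 4)`: Kodaira type `II` at `2`, `ord₂ Δ_min = 6`.**  On the
translate `y² = x³ + 3x² + (a+3)x + (a+1)` (singular point of the reduction moved to `(0,0)`):
`2 ∣ a₃ = 0, a₄ = a + 3, a₆ = a + 1, b₂ = 12`, and `ord₂(a + 1) = 1`, so Step 3 fires; the equation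
is minimal since `ord₂ Δ = ord₂(-64a³) = 6 < 12`.  Silverman *ATAEC* IV.9.4 Steps 1–3, Table 4.1.
[cite: SilvermanATAEC1994, IV.9.4 Steps 1–3 (PDF pp. 344–345) and Table 4.1] -/
theorem kodairaSymbolAt_and_ordMinimalDiscriminant_of_j1728_emod_four_eq_one [W.IsElliptic]
    (hv : natGenerator v = 2) {a : ℤ} (ha : a % 4 = 1) {C : VariableChange ℚ}
    (hC : C • W = ⟨0, 0, 0, (a : ℚ), 0⟩) :
    W.kodairaSymbolAt v = .II ∧ W.ordMinimalDiscriminant v = 6 := by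
  obtain ⟨t, ht⟩ : ∃ t : ℤ, a = 4 * t + 1 := ⟨a / 4, by omega⟩
  set M : WeierstrassCurve ℚ := ⟨0, 3, 0, (a : ℚ) + 3, (a : ℚ) + 1⟩ with hMdef
  have hM : M = ((⟨1, 1, 0, 0⟩ : VariableChange ℚ) * C) • W := by
    rw [mul_smul, hC, smul_mk_a_eq_translate]
  have hv1 : v.valuation ℚ (3 : ℚ) = 1 := by
    have := Rat.valuation_intCast_eq_one v (n := 3) (by rw [hv]; decide)
    exact_mod_cast this
  have ha₄ : v.valuation ℚ M.a₄ ≤ WithZero.exp (-1 : ℤ) := by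
    rw [show M.a₄ = ((a + 3 : ℤ) : ℚ) by push_cast; rfl]
    exact valuation_le_of_two_pow_dvd v hv (e := 1) ⟨2 * t + 2, by rw [ht]; ring⟩
  have ha₆ : v.valuation ℚ M.a₆ = WithZero.exp (-((1 : ℕ) : ℤ)) := by
    rw [show M.a₆ = (2 : ℚ) ^ 1 * ((2 * t + 1 : ℤ) : ℚ) by
      simp only [hMdef, ht]; push_cast; ring]
    exact valuation_two_pow_mul_of_odd v hv 1 (by omega)
  have hb₂ : v.valuation ℚ M.b₂ ≤ WithZero.exp (-1 : ℤ) := by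
    rw [show M.b₂ = ((12 : ℤ) : ℚ) by simp only [hMdef, WeierstrassCurve.b₂]; norm_num]
    exact valuation_le_of_two_pow_dvd v hv (e := 1) ⟨6, by norm_num⟩
  have hΔ : v.valuation ℚ M.Δ = WithZero.exp (-((6 : ℕ) : ℤ)) := by
    have e : M.Δ = (2 : ℚ) ^ 6 * ((-a ^ 3 : ℤ) : ℚ) := by
      simp only [hMdef, WeierstrassCurve.Δ, WeierstrassCurve.b₂, WeierstrassCurve.b₄,
        WeierstrassCurve.b₆, WeierstrassCurve.b₈]
      push_cast; ring
    rw [e]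
    refine valuation_two_pow_mul_of_odd v hv 6 fun h ↦ ?_
    have h2a : (2 : ℤ) ∣ a := Int.prime_two.dvd_of_dvd_pow (Int.dvd_neg.mp h)
    omega
  refine W.kodairaSymbolAt_and_ordMinimalDiscriminant_of_step2_model v M _ hM
    (by rw [show M.a₁ = 0 from rfl, map_zero]; exact zero_le_one) (by rw [show M.a₂ = 3 from rfl, hv1])
    (by rw [show M.a₃ = 0 from rfl, map_zero]; exact zero_le) ha₄
    (by rw [ha₆]; exact WithZero.exp_le_exp.mpr (by norm_num)) hb₂ (by norm_num) (by norm_num) hΔ (Or.inl ⟨ha₆, rfl⟩)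

/-- **`y² = x³ + ax`, `a ≡ 3 (mod 4)`: Kodaira type `III` at `2`, `ord₂ Δ_min = 6`.**  On the
translate `y² = x³ + 3x² + (a+3)x + (a+1)`: `4 ∣ a₆ = a + 1` (Step 3 fails) and
`b₈ = 12(a+1) - (a+3)² = 4(3 - 4t²)` for `a = 4t + 3`, of order `2 < 3`, so Step 4 fires.
Silverman *ATAEC* IV.9.4 Steps 1–4, Table 4.1 (the curve `32a2: y² = x³ - x` has `f₂ = 5`).
[cite: SilvermanATAEC1994, IV.9.4 Steps 1–4 (PDF pp. 344–345) and Table 4.1] -/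
theorem kodairaSymbolAt_and_ordMinimalDiscriminant_of_j1728_emod_four_eq_three [W.IsElliptic]
    (hv : natGenerator v = 2) {a : ℤ} (ha : a % 4 = 3) {C : VariableChange ℚ}
    (hC : C • W = ⟨0, 0, 0, (a : ℚ), 0⟩) :
    W.kodairaSymbolAt v = .III ∧ W.ordMinimalDiscriminant v = 6 := by
  obtain ⟨t, ht⟩ : ∃ t : ℤ, a = 4 * t + 3 := ⟨a / 4, by omega⟩
  set M : WeierstrassCurve ℚ := ⟨0, 3, 0, (a : ℚ) + 3, (a : ℚ) + 1⟩ with hMdef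
  have hM : M = ((⟨1, 1, 0, 0⟩ : VariableChange ℚ) * C) • W := by
    rw [mul_smul, hC, smul_mk_a_eq_translate]
  have hv1 : v.valuation ℚ (3 : ℚ) = 1 := by
    have := Rat.valuation_intCast_eq_one v (n := 3) (by rw [hv]; decide)
    exact_mod_cast this
  have ha₄ : v.valuation ℚ M.a₄ ≤ WithZero.exp (-1 : ℤ) := by
    rw [show M.a₄ = ((a + 3 : ℤ) : ℚ) by push_cast; rfl]
    exact valuation_le_of_two_pow_dvd v hv (e := 1) ⟨2 * t + 3, by rw [ht]; ring⟩
  have ha₆ : v.valuation ℚ M.a₆ ≤ WithZero.exp (-2 : ℤ) := by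
    rw [show M.a₆ = ((a + 1 : ℤ) : ℚ) by push_cast; rfl]
    exact valuation_le_of_two_pow_dvd v hv (e := 2) ⟨t + 1, by rw [ht]; ring⟩
  have hb₂ : v.valuation ℚ M.b₂ ≤ WithZero.exp (-1 : ℤ) := by
    rw [show M.b₂ = ((12 : ℤ) : ℚ) by simp only [hMdef, WeierstrassCurve.b₂]; norm_num]
    exact valuation_le_of_two_pow_dvd v hv (e := 1) ⟨6, by norm_num⟩
  have hb₈ : v.valuation ℚ M.b₈ = WithZero.exp (-((2 : ℕ) : ℤ)) := by
    rw [show M.b₈ = (2 : ℚ) ^ 2 * ((3 - 4 * t ^ 2 : ℤ) : ℚ) by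
      simp only [hMdef, WeierstrassCurve.b₈, ht]; push_cast; ring]
    refine valuation_two_pow_mul_of_odd v hv 2 fun h ↦ ?_
    have h3 : (2 : ℤ) ∣ 3 := by
      have := dvd_add h (⟨2 * t ^ 2, by ring⟩ : (2 : ℤ) ∣ 4 * t ^ 2)
      rwa [sub_add_cancel] at this
    omega
  have hΔ : v.valuation ℚ M.Δ = WithZero.exp (-((6 : ℕ) : ℤ)) := by
    have e : M.Δ = (2 : ℚ) ^ 6 * ((-a ^ 3 : ℤ) : ℚ) := by
      simp only [hMdef, WeierstrassCurve.Δ, WeierstrassCurve.b₂, WeierstrassCurve.b₄,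
        WeierstrassCurve.b₆, WeierstrassCurve.b₈]
      push_cast; ring
    rw [e]
    refine valuation_two_pow_mul_of_odd v hv 6 fun h ↦ ?_
    have h2a : (2 : ℤ) ∣ a := Int.prime_two.dvd_of_dvd_pow (Int.dvd_neg.mp h)
    omega
  refine W.kodairaSymbolAt_and_ordMinimalDiscriminant_of_step2_model v M _ hM
    (by rw [show M.a₁ = 0 from rfl, map_zero]; exact zero_le_one) (by rw [show M.a₂ = 3 from rfl, hv1])
    (by rw [show M.a₃ = 0 from rfl, map_zero]; exact zero_le) ha₄
    (ha₆.trans (WithZero.exp_le_exp.mpr (by norm_num))) hb₂ (by norm_num) (by norm_num) hΔ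
    (Or.inr ⟨ha₆, ⟨2, by norm_num, hb₈⟩, rfl⟩)

/-- **`y² = x³ + 2mx`, `m` odd: Kodaira type `III` at `2`, `ord₂ Δ_min = 9`.**  The equation is
already step-2 normalised (`a₃ = a₆ = b₂ = 0`, `2 ∣ a₄`), `4 ∣ a₆ = 0`, and `b₈ = -a₄² = -4m²` has
order `2 < 3`: Step 4 fires; minimal since `ord₂ Δ = ord₂(-512m³) = 9 < 12`.  Silverman *ATAEC*
IV.9.4 Steps 1–4, Table 4.1 (`256b1, 256c1: y² = x³ ∓ 2x`, `f₂ = 8`).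
[cite: SilvermanATAEC1994, IV.9.4 Steps 1–4 (PDF pp. 344–345) and Table 4.1] -/
theorem kodairaSymbolAt_and_ordMinimalDiscriminant_of_j1728_two_mul_odd [W.IsElliptic]
    (hv : natGenerator v = 2) {m : ℤ} (hm : ¬ (2 : ℤ) ∣ m) {C : VariableChange ℚ}
    (hC : C • W = ⟨0, 0, 0, 2 * (m : ℚ), 0⟩) :
    W.kodairaSymbolAt v = .III ∧ W.ordMinimalDiscriminant v = 9 := by
  set M : WeierstrassCurve ℚ := ⟨0, 0, 0, 2 * (m : ℚ), 0⟩ with hMdef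
  have hM : M = C • W := hC.symm
  have ha₄ : v.valuation ℚ M.a₄ ≤ WithZero.exp (-1 : ℤ) := by
    rw [show M.a₄ = (2 : ℚ) ^ 1 * ((m : ℤ) : ℚ) by simp only [hMdef]; ring]
    exact (valuation_two_pow_mul_of_odd v hv 1 hm).trans_le (WithZero.exp_le_exp.mpr (by norm_num))
  have hb₈ : v.valuation ℚ M.b₈ = WithZero.exp (-((2 : ℕ) : ℤ)) := by
    rw [show M.b₈ = (2 : ℚ) ^ 2 * ((-m ^ 2 : ℤ) : ℚ) by
      simp only [hMdef, WeierstrassCurve.b₈]; push_cast; ring]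
    refine valuation_two_pow_mul_of_odd v hv 2 fun h ↦ hm ?_
    exact Int.prime_two.dvd_of_dvd_pow (Int.dvd_neg.mp h)
  have hΔ : v.valuation ℚ M.Δ = WithZero.exp (-((9 : ℕ) : ℤ)) := by
    have e : M.Δ = (2 : ℚ) ^ 9 * ((-m ^ 3 : ℤ) : ℚ) := by
      simp only [hMdef, WeierstrassCurve.Δ, WeierstrassCurve.b₂, WeierstrassCurve.b₄,
        WeierstrassCurve.b₆, WeierstrassCurve.b₈]
      push_cast; ring
    rw [e]
    refine valuation_two_pow_mul_of_odd v hv 9 fun h ↦ hm ?_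
    exact Int.prime_two.dvd_of_dvd_pow (Int.dvd_neg.mp h)
  refine W.kodairaSymbolAt_and_ordMinimalDiscriminant_of_step2_model v M _ hM
    (by rw [show M.a₁ = 0 from rfl, map_zero]; exact zero_le_one) (by rw [show M.a₂ = 0 from rfl, map_zero]; exact zero_le_one)
    (by rw [show M.a₃ = 0 from rfl, map_zero]; exact zero_le) ha₄
    (by rw [show M.a₆ = 0 from rfl, map_zero]; exact zero_le)
    (by rw [show M.b₂ = 0 by simp [hMdef, WeierstrassCurve.b₂], map_zero]; exact zero_le)
    (by norm_num) (by norm_num) hΔ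
    (Or.inr ⟨by rw [show M.a₆ = 0 from rfl, map_zero]; exact zero_le, ⟨2, by norm_num, hb₈⟩, rfl⟩)

/-- **`y² = x³ + 8mx`, `m` odd: Kodaira type `III*` at `2`, `ord₂ Δ_min = 15`.**  The equation is
step-9 normalised (`a₁ = a₂ = a₃ = a₆ = 0`, `8 ∣ a₄ = 8m`) with `16 ∤ a₄`, so Step 9 returns `III*`
(`kodairaSymbolOfMinimal_eq_IIIstar_of_step9`); it is minimal at `2` by Kraus's criterion
(`isMinimal_of_kraus_fails`): `c₄ = -384m` has order `7 < 8`, and the descended invariants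
`c₄' = -24m` (order `3 < 4`), `c₆' = 0` (`c₆' + 1` a unit) satisfy neither of Kraus's conditions.
`ord₂ Δ = ord₂(-2¹⁵m³) = 15`.  Silverman *ATAEC* IV.9.4 Steps 1–9, Table 4.1 (`256a1, 256d1:
y² = x³ ∓ 8x`, `f₂ = 8`); Kraus 1989, Prop. 2.
[cite: SilvermanATAEC1994, IV.9.4 Steps 1–9 (PDF pp. 344–346) and Table 4.1] [cite: Kraus1989, Prop. 2] -/
theorem kodairaSymbolAt_and_ordMinimalDiscriminant_of_j1728_eight_mul_odd [W.IsElliptic]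
    (hv : natGenerator v = 2) {m : ℤ} (hm : ¬ (2 : ℤ) ∣ m) {C : VariableChange ℚ}
    (hC : C • W = ⟨0, 0, 0, 8 * (m : ℚ), 0⟩) :
    W.kodairaSymbolAt v = .IIIstar ∧ W.ordMinimalDiscriminant v = 15 := by
  haveI := perfectField_residueField_adicCompletionIntegers (K := ℚ) v
  set M : WeierstrassCurve ℚ := ⟨0, 0, 0, 8 * (m : ℚ), 0⟩ with hMdef
  have hM : M = C • W := hC.symm
  haveI hMell : M.IsElliptic := by rw [hM]; infer_instance
  -- valuations over `ℚ`
  have hvMa₄ : v.valuation ℚ M.a₄ = WithZero.exp (-((3 : ℕ) : ℤ)) := by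
    rw [show M.a₄ = (2 : ℚ) ^ 3 * ((m : ℤ) : ℚ) by simp only [hMdef]; ring,
      valuation_two_pow_mul_of_odd v hv 3 hm]
  have hm3 : ¬ (2 : ℤ) ∣ -m ^ 3 := fun h ↦ hm (Int.prime_two.dvd_of_dvd_pow (Int.dvd_neg.mp h))
  have hvMΔ : v.valuation ℚ M.Δ = WithZero.exp (-((15 : ℕ) : ℤ)) := by
    have e : M.Δ = (2 : ℚ) ^ 15 * ((-m ^ 3 : ℤ) : ℚ) := by
      simp only [hMdef, WeierstrassCurve.Δ, WeierstrassCurve.b₂, WeierstrassCurve.b₄,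
        WeierstrassCurve.b₆, WeierstrassCurve.b₈]
      push_cast; ring
    rw [e, valuation_two_pow_mul_of_odd v hv 15 hm3]
  have hvMc₄ : v.valuation ℚ M.c₄ = WithZero.exp (-((7 : ℕ) : ℤ)) := by
    have e : M.c₄ = (2 : ℚ) ^ 7 * ((-3 * m : ℤ) : ℚ) := by
      simp only [hMdef, WeierstrassCurve.c₄, WeierstrassCurve.b₂, WeierstrassCurve.b₄]
      push_cast; ring
    rw [e]
    exact valuation_two_pow_mul_of_odd v hv 7 (by omega)
  have hMc₆ : M.c₆ = 0 := by
    simp only [hMdef, WeierstrassCurve.c₆, WeierstrassCurve.b₂, WeierstrassCurve.b₄,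
      WeierstrassCurve.b₆]
    ring
  -- integrality of `X = M ⊗ ℚ₂`
  have hexp : ∀ k : ℕ, WithZero.exp (-(k : ℤ)) ≤ (1 : WithZero (Multiplicative ℤ)) := fun k ↦ by
    rw [← WithZero.exp_zero, WithZero.exp_le_exp]; omega
  have hint : M.IsIntegralAt v := by
    refine M.isIntegralAt_of_valuation_le_one v ?_ ?_ ?_ ?_ ?_
    · rw [show M.a₁ = 0 from rfl, map_zero]; exact zero_le_one
    · rw [show M.a₂ = 0 from rfl, map_zero]; exact zero_le_one
    · rw [show M.a₃ = 0 from rfl, map_zero]; exact zero_le_one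
    · rw [hvMa₄]; exact hexp 3
    · rw [show M.a₆ = 0 from rfl, map_zero]; exact zero_le_one
  set X := M.baseChange (v.adicCompletion ℚ) with hX
  haveI hXint : X.IsIntegral (v.adicCompletionIntegers ℚ) := hint
  haveI hXell : X.IsElliptic := by rw [hX, WeierstrassCurve.baseChange]; infer_instance
  have hXc₄ : Valued.v X.c₄ = WithZero.exp (-((7 : ℕ) : ℤ)) := by
    rw [hX, WeierstrassCurve.baseChange, map_c₄, valued_algebraMap_adicCompletion, hvMc₄]
  have hXc₆ : X.c₆ = 0 := by
    rw [hX, WeierstrassCurve.baseChange, map_c₆, hMc₆, map_zero]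
  -- minimality (Kraus)
  have V2 := valued_two v hv
  haveI hXmin : X.IsMinimal (v.adicCompletionIntegers ℚ) := by
    refine isMinimal_of_kraus_fails v hv X
      (by rw [hXc₄]; exact WithZero.exp_lt_exp.mpr (by norm_num)) fun w hw hK ↦ ?_
    have V16 : Valued.v (16 : v.adicCompletion ℚ) = WithZero.exp (-4 : ℤ) := by
      rw [show (16 : v.adicCompletion ℚ) = 2 ^ 4 by norm_num, Valuation.map_pow, V2,
        ← WithZero.exp_nsmul]; norm_num
    rcases hK with ⟨h4, -⟩ | h6
    · have hden : Valued.v ((16 : v.adicCompletion ℚ) * w ^ 4) = WithZero.exp (-4 : ℤ) := by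
        rw [Valuation.map_mul, Valuation.map_pow, hw, one_pow, mul_one, V16]
      have h16w : (16 : v.adicCompletion ℚ) * w ^ 4 ≠ 0 := by
        intro h0; rw [h0, Valuation.map_zero] at hden; exact WithZero.coe_ne_zero hden.symm
      have hq : Valued.v (X.c₄ / (16 * w ^ 4)) = WithZero.exp (-3 : ℤ) := by
        have h := congrArg Valued.v (div_mul_cancel₀ X.c₄ h16w)
        rw [Valuation.map_mul, hden, hXc₄] at h
        rw [eq_div_of_mul_eq WithZero.coe_ne_zero h, ← WithZero.exp_sub]
        congr 1
      rw [hq, WithZero.exp_le_exp] at h4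
      omega
    · rw [hXc₆, zero_div, zero_add, Valuation.map_one, ← WithZero.exp_zero, WithZero.exp_le_exp] at h6
      omega
  -- the `ℤ₂`-model and Step 9
  set I := X.integralModel (v.adicCompletionIntegers ℚ) with hI
  have hinj : Function.Injective (algebraMap (v.adicCompletionIntegers ℚ) (v.adicCompletion ℚ)) :=
    IsFractionRing.injective _ _
  have e1 : I.a₁ = 0 := hinj (by
    rw [hI, integralModel_a₁_eq, hX, WeierstrassCurve.baseChange, map_a₁, map_zero]; rfl)
  have e2 : I.a₂ = 0 := hinj (by
    rw [hI, integralModel_a₂_eq, hX, WeierstrassCurve.baseChange, map_a₂, map_zero]; rfl)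
  have e3 : I.a₃ = 0 := hinj (by
    rw [hI, integralModel_a₃_eq, hX, WeierstrassCurve.baseChange, map_a₃, map_zero]; rfl)
  have e6 : I.a₆ = 0 := hinj (by
    rw [hI, integralModel_a₆_eq, hX, WeierstrassCurve.baseChange, map_a₆, map_zero]; rfl)
  have hIa₄ : Valued.v ((I.a₄ : v.adicCompletionIntegers ℚ) : v.adicCompletion ℚ) =
      WithZero.exp (-((3 : ℕ) : ℤ)) := by
    rw [show ((I.a₄ : v.adicCompletionIntegers ℚ) : v.adicCompletion ℚ) = X.a₄ from
      integralModel_a₄_eq (v.adicCompletionIntegers ℚ) X, hX, WeierstrassCurve.baseChange, map_a₄,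
      valued_algebraMap_adicCompletion, hvMa₄]
  have hIΔ : Valued.v ((I.Δ : v.adicCompletionIntegers ℚ) : v.adicCompletion ℚ) =
      WithZero.exp (-((15 : ℕ) : ℤ)) := by
    rw [show ((I.Δ : v.adicCompletionIntegers ℚ) : v.adicCompletion ℚ) = X.Δ from
      integralModel_Δ_eq (v.adicCompletionIntegers ℚ) X, hX, WeierstrassCurve.baseChange, map_Δ,
      valued_algebraMap_adicCompletion, hvMΔ]
  have hordΔ : (IsDiscreteValuationRing.addVal (v.adicCompletionIntegers ℚ) I.Δ).toNat = 15 :=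
    addVal_toNat_eq_of_valued_eq v hIΔ
  have g4 : uniformizer (v.adicCompletionIntegers ℚ) ^ 3 ∣ I.a₄ :=
    uniformizer_pow_dvd_of_valued_le v hIa₄.le
  have h9 : ¬ uniformizer (v.adicCompletionIntegers ℚ) ^ 4 ∣ I.a₄ :=
    not_pow_succ_dvd_of_valued_eq v hIa₄
  have hK : I.kodairaSymbolOfMinimal = .IIIstar :=
    kodairaSymbolOfMinimal_eq_IIIstar_of_step9 (by rw [e1]; exact dvd_zero _)
      (by rw [e2]; exact dvd_zero _) (by rw [e3]; exact dvd_zero _) g4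
      (by rw [e6]; exact dvd_zero _) h9
  -- read `kodairaSymbolAt` and `ord Δ_min` of `W` on the minimal model `X`
  have hrel : X = (C.map (algebraMap ℚ (v.adicCompletion ℚ))) • W.baseChange (v.adicCompletion ℚ) := by
    rw [hX, hM, WeierstrassCurve.baseChange, WeierstrassCurve.baseChange, map_variableChange]
  refine ⟨?_, ?_⟩
  · rw [W.kodairaSymbolAt_eq_kodairaSymbolOfMinimal_of_isMinimal v X _ hrel X.isUnit_Δ.ne_zero, ← hI,
      hK]
  · rw [W.ordMinimalDiscriminant_eq_of_isMinimal v X _ hrel X.isUnit_Δ.ne_zero, ← hI, hordΔ]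

set_option maxHeartbeats 400000 in
/-- **`y² = x³ + 4mx`, `m` odd: Kodaira type `I₂*` (`m ≡ 3 (mod 4)`) or `I₃*` (`m ≡ 1 (mod 4)`)
at `2`, `ord₂ Δ_min = 12`.**  The equation is minimal at `2` (Kraus: `c₄ = -192m` of order
`6 < 8`, descended invariants `c₄' = -12m` of order `2 < 4`, `c₆' = 0`); `ord₂ Δ = ord₂(-2¹²m³) = 12`.
Tate's algorithm (`kodairaSymbolOfMinimal_eq_Istar_of_models`): the equation is step-6 normalised
with cubic `T³ + ūT` (`u` a unit), two distinct roots in characteristic `2` (Step 7); the double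
root `T = 1` is moved to `0` by `x ↦ x + 2`, giving `W₇ : y² = x³ + 6x² + (4m+12)x + (8m+8)`;
in round `0` the quadratic `Y² - ā₆,₄` always has a double root; for `m ≡ 3 (mod 4)`
(`32 ∣ 8m + 8`, `ord₂(4m + 12) = 3`) the second quadratic `ā₂,₁X² + ā₄,₃X + ā₆,₅` has `ā₄,₃ ≠ 0`,
whence `I₂*`; for `m ≡ 1 (mod 4)` one first translates `y ↦ y + 4`
(`W₁ : a₃ = 8`, `a₆ = 8m - 8`), the second quadratic has `ā₄,₃ = 0` (`16 ∣ 4m + 12`), and round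
`1` — on `W₁` itself if `m ≡ 1 (mod 8)`, on its translate `x ↦ x + 4`
(`a₂ = 18`, `a₄ = 4m + 108`, `a₆ = 24m + 200`) if `m ≡ 5 (mod 8)` — returns at its first
quadratic `Y² + ā₃,₃Y - ā₆,₆`, `ā₃,₃ ≠ 0`: `I₃*`.  Silverman *ATAEC* IV.9.4 Steps 1–7, Table 4.1
(`32a1: y² = x³ + 4x`, `f₂ = 5`; `64a1: y² = x³ - 4x`, `f₂ = 6`); Kraus 1989, Prop. 2.
[cite: SilvermanATAEC1994, IV.9.4 Steps 1–7 (PDF pp. 344–346) and Table 4.1] [cite: Kraus1989, Prop. 2] -/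
theorem kodairaSymbolAt_and_ordMinimalDiscriminant_of_j1728_four_mul_odd [W.IsElliptic]
    (hv : natGenerator v = 2) {m : ℤ} (hm : ¬ (2 : ℤ) ∣ m) {C : VariableChange ℚ}
    (hC : C • W = ⟨0, 0, 0, 4 * (m : ℚ), 0⟩) :
    W.kodairaSymbolAt v = .Istar (if m % 4 = 3 then 2 else 3) ∧
      W.ordMinimalDiscriminant v = 12 := by
  haveI := perfectField_residueField_adicCompletionIntegers (K := ℚ) v
  set M : WeierstrassCurve ℚ := ⟨0, 0, 0, 4 * (m : ℚ), 0⟩ with hMdef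
  have hM : M = C • W := hC.symm
  haveI hMell : M.IsElliptic := by rw [hM]; infer_instance
  -- valuations over `ℚ`
  have hvMa₄ : v.valuation ℚ M.a₄ = WithZero.exp (-((2 : ℕ) : ℤ)) := by
    rw [show M.a₄ = (2 : ℚ) ^ 2 * ((m : ℤ) : ℚ) by simp only [hMdef]; ring,
      valuation_two_pow_mul_of_odd v hv 2 hm]
  have hm3 : ¬ (2 : ℤ) ∣ -m ^ 3 := fun h ↦ hm (Int.prime_two.dvd_of_dvd_pow (Int.dvd_neg.mp h))
  have hvMΔ : v.valuation ℚ M.Δ = WithZero.exp (-((12 : ℕ) : ℤ)) := by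
    have e : M.Δ = (2 : ℚ) ^ 12 * ((-m ^ 3 : ℤ) : ℚ) := by
      simp only [hMdef, WeierstrassCurve.Δ, WeierstrassCurve.b₂, WeierstrassCurve.b₄,
        WeierstrassCurve.b₆, WeierstrassCurve.b₈]
      push_cast; ring
    rw [e, valuation_two_pow_mul_of_odd v hv 12 hm3]
  have hvMc₄ : v.valuation ℚ M.c₄ = WithZero.exp (-((6 : ℕ) : ℤ)) := by
    have e : M.c₄ = (2 : ℚ) ^ 6 * ((-3 * m : ℤ) : ℚ) := by
      simp only [hMdef, WeierstrassCurve.c₄, WeierstrassCurve.b₂, WeierstrassCurve.b₄]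
      push_cast; ring
    rw [e]
    exact valuation_two_pow_mul_of_odd v hv 6 (by omega)
  have hMc₆ : M.c₆ = 0 := by
    simp only [hMdef, WeierstrassCurve.c₆, WeierstrassCurve.b₂, WeierstrassCurve.b₄,
      WeierstrassCurve.b₆]
    ring
  -- integrality of `X = M ⊗ ℚ₂`
  have hexp : ∀ k : ℕ, WithZero.exp (-(k : ℤ)) ≤ (1 : WithZero (Multiplicative ℤ)) := fun k ↦ by
    rw [← WithZero.exp_zero, WithZero.exp_le_exp]; omega
  have hint : M.IsIntegralAt v := by
    refine M.isIntegralAt_of_valuation_le_one v ?_ ?_ ?_ ?_ ?_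
    · rw [show M.a₁ = 0 from rfl, map_zero]; exact zero_le_one
    · rw [show M.a₂ = 0 from rfl, map_zero]; exact zero_le_one
    · rw [show M.a₃ = 0 from rfl, map_zero]; exact zero_le_one
    · rw [hvMa₄]; exact hexp 2
    · rw [show M.a₆ = 0 from rfl, map_zero]; exact zero_le_one
  set X := M.baseChange (v.adicCompletion ℚ) with hX
  haveI hXint : X.IsIntegral (v.adicCompletionIntegers ℚ) := hint
  haveI hXell : X.IsElliptic := by rw [hX, WeierstrassCurve.baseChange]; infer_instance
  have hXc₄ : Valued.v X.c₄ = WithZero.exp (-((6 : ℕ) : ℤ)) := by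
    rw [hX, WeierstrassCurve.baseChange, map_c₄, valued_algebraMap_adicCompletion, hvMc₄]
  have hXc₆ : X.c₆ = 0 := by
    rw [hX, WeierstrassCurve.baseChange, map_c₆, hMc₆, map_zero]
  -- minimality (Kraus)
  have V2 := valued_two v hv
  haveI hXmin : X.IsMinimal (v.adicCompletionIntegers ℚ) := by
    refine isMinimal_of_kraus_fails v hv X
      (by rw [hXc₄]; exact WithZero.exp_lt_exp.mpr (by norm_num)) fun w hw hK ↦ ?_
    have V16 : Valued.v (16 : v.adicCompletion ℚ) = WithZero.exp (-4 : ℤ) := by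
      rw [show (16 : v.adicCompletion ℚ) = 2 ^ 4 by norm_num, Valuation.map_pow, V2,
        ← WithZero.exp_nsmul]; norm_num
    rcases hK with ⟨h4, -⟩ | h6
    · have hden : Valued.v ((16 : v.adicCompletion ℚ) * w ^ 4) = WithZero.exp (-4 : ℤ) := by
        rw [Valuation.map_mul, Valuation.map_pow, hw, one_pow, mul_one, V16]
      have h16w : (16 : v.adicCompletion ℚ) * w ^ 4 ≠ 0 := by
        intro h0; rw [h0, Valuation.map_zero] at hden; exact WithZero.coe_ne_zero hden.symm
      have hq : Valued.v (X.c₄ / (16 * w ^ 4)) = WithZero.exp (-2 : ℤ) := by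
        have h := congrArg Valued.v (div_mul_cancel₀ X.c₄ h16w)
        rw [Valuation.map_mul, hden, hXc₄] at h
        rw [eq_div_of_mul_eq WithZero.coe_ne_zero h, ← WithZero.exp_sub]
        congr 1
      rw [hq, WithZero.exp_le_exp] at h4
      omega
    · rw [hXc₆, zero_div, zero_add, Valuation.map_one, ← WithZero.exp_zero, WithZero.exp_le_exp] at h6
      omega
  -- the `ℤ₂`-model `I`
  set I := X.integralModel (v.adicCompletionIntegers ℚ) with hI
  have hinj : Function.Injective (algebraMap (v.adicCompletionIntegers ℚ) (v.adicCompletion ℚ)) :=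
    IsFractionRing.injective _ _
  have e1 : I.a₁ = 0 := hinj (by
    rw [hI, integralModel_a₁_eq, hX, WeierstrassCurve.baseChange, map_a₁, map_zero]; rfl)
  have e2 : I.a₂ = 0 := hinj (by
    rw [hI, integralModel_a₂_eq, hX, WeierstrassCurve.baseChange, map_a₂, map_zero]; rfl)
  have e3 : I.a₃ = 0 := hinj (by
    rw [hI, integralModel_a₃_eq, hX, WeierstrassCurve.baseChange, map_a₃, map_zero]; rfl)
  have e6 : I.a₆ = 0 := hinj (by
    rw [hI, integralModel_a₆_eq, hX, WeierstrassCurve.baseChange, map_a₆, map_zero]; rfl)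
  have hIa₄K : ((I.a₄ : v.adicCompletionIntegers ℚ) : v.adicCompletion ℚ) =
      algebraMap ℚ (v.adicCompletion ℚ) (4 * (m : ℚ)) := by
    rw [show ((I.a₄ : v.adicCompletionIntegers ℚ) : v.adicCompletion ℚ) = X.a₄ from
      integralModel_a₄_eq (v.adicCompletionIntegers ℚ) X, hX, WeierstrassCurve.baseChange, map_a₄]
  have hIa₄ : Valued.v ((I.a₄ : v.adicCompletionIntegers ℚ) : v.adicCompletion ℚ) =
      WithZero.exp (-((2 : ℕ) : ℤ)) := by
    rw [hIa₄K, valued_algebraMap_adicCompletion]; exact hvMa₄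
  have hIΔ : Valued.v ((I.Δ : v.adicCompletionIntegers ℚ) : v.adicCompletion ℚ) =
      WithZero.exp (-((12 : ℕ) : ℤ)) := by
    rw [show ((I.Δ : v.adicCompletionIntegers ℚ) : v.adicCompletion ℚ) = X.Δ from
      integralModel_Δ_eq (v.adicCompletionIntegers ℚ) X, hX, WeierstrassCurve.baseChange, map_Δ,
      valued_algebraMap_adicCompletion, hvMΔ]
  have hordΔ : (IsDiscreteValuationRing.addVal (v.adicCompletionIntegers ℚ) I.Δ).toNat = 12 :=
    addVal_toNat_eq_of_valued_eq v hIΔ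
  -- `2 = ϖ ε`, residue characteristic `2`
  set ϖ := uniformizer (v.adicCompletionIntegers ℚ)
  have hϖ : Irreducible ϖ := irreducible_uniformizer
  obtain ⟨ε, hεu, h2ε⟩ := exists_isUnit_two_eq_uniformizer_mul v hv
  have h2res : (2 : IsLocalRing.ResidueField (v.adicCompletionIntegers ℚ)) = 0 :=
    residue_two_eq_zero h2ε
  have h3res : (3 : IsLocalRing.ResidueField (v.adicCompletionIntegers ℚ)) = 1 := by
    rw [show (3 : IsLocalRing.ResidueField (v.adicCompletionIntegers ℚ)) = 2 + 1 by norm_num,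
      h2res, zero_add]
  have h4res : (4 : IsLocalRing.ResidueField (v.adicCompletionIntegers ℚ)) = 0 := by
    rw [show (4 : IsLocalRing.ResidueField (v.adicCompletionIntegers ℚ)) = 2 * 2 by norm_num,
      h2res, mul_zero]
  -- valuations of rational integers in `ℚ_v`, and a transfer lemma for elements `I.a₄ + c`
  have hcastI : ∀ (a c : ℤ),
      (((a * I.a₄ + c : v.adicCompletionIntegers ℚ) : v.adicCompletionIntegers ℚ) :
        v.adicCompletion ℚ) = algebraMap ℚ (v.adicCompletion ℚ) ((a * (4 * m) + c : ℤ) : ℚ) := by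
    intro a c
    rw [AddMemClass.coe_add, MulMemClass.coe_mul, SubringClass.coe_intCast,
      SubringClass.coe_intCast, hIa₄K, ← map_intCast (algebraMap ℚ (v.adicCompletion ℚ)) a,
      ← map_intCast (algebraMap ℚ (v.adicCompletion ℚ)) c, ← map_mul, ← map_add]
    congr 1
    push_cast
    ring
  have hval : ∀ (a c : ℤ) (k : ℕ) {n : ℤ}, ¬ (2 : ℤ) ∣ n → a * (4 * m) + c = 2 ^ k * n →
      Valued.v (((a * I.a₄ + c : v.adicCompletionIntegers ℚ) : v.adicCompletionIntegers ℚ) :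
        v.adicCompletion ℚ) = WithZero.exp (-(k : ℤ)) := by
    intro a c k n hn hc
    rw [hcastI, valued_algebraMap_adicCompletion, hc, Int.cast_mul, Int.cast_pow, Int.cast_ofNat]
    exact valuation_two_pow_mul_of_odd v hv k hn
  have hvalle : ∀ (a c : ℤ) (k : ℕ), (2 : ℤ) ^ k ∣ a * (4 * m) + c →
      Valued.v (((a * I.a₄ + c : v.adicCompletionIntegers ℚ) : v.adicCompletionIntegers ℚ) :
        v.adicCompletion ℚ) ≤ WithZero.exp (-(k : ℤ)) := by
    intro a c k hc
    rw [hcastI, valued_algebraMap_adicCompletion]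
    exact valuation_le_of_two_pow_dvd v hv hc
  have hvalC : ∀ (k : ℕ) {n : ℤ}, ¬ (2 : ℤ) ∣ n →
      Valued.v ((((2 : ℤ) ^ k * n : ℤ) : v.adicCompletionIntegers ℚ) : v.adicCompletion ℚ) =
        WithZero.exp (-(k : ℤ)) := by
    intro k n hn
    rw [SubringClass.coe_intCast, ← map_intCast (algebraMap ℚ (v.adicCompletion ℚ)),
      valued_algebraMap_adicCompletion, Int.cast_mul, Int.cast_pow, Int.cast_ofNat]
    exact valuation_two_pow_mul_of_odd v hv k hn
  -- divisibility from valuations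
  have dvd_of_le : ∀ {x : v.adicCompletionIntegers ℚ} {k : ℕ},
      Valued.v (x : v.adicCompletion ℚ) ≤ WithZero.exp (-(k : ℤ)) → ϖ ^ k ∣ x :=
    fun h ↦ uniformizer_pow_dvd_of_valued_le v h
  -- Steps 2–6 on `I` itself
  have n4 : ϖ ∣ I.a₄ := by
    have := dvd_of_le (k := 1) (hIa₄.le.trans (WithZero.exp_le_exp.mpr (by norm_num)))
    rwa [pow_one] at this
  have q4 : ϖ ^ 2 ∣ I.a₄ := dvd_of_le hIa₄.le
  have q4n : ¬ ϖ ^ 3 ∣ I.a₄ := not_pow_succ_dvd_of_valued_eq v hIa₄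
  have hΔI : ϖ ∣ I.Δ := by
    have := dvd_of_le (k := 1) (hIΔ.le.trans (WithZero.exp_le_exp.mpr (by norm_num)))
    rwa [pow_one] at this
  have hb₂I : ϖ ∣ I.b₂ := by rw [WeierstrassCurve.b₂, e1, e2]; simp
  have hb₆I : ϖ ^ 3 ∣ I.b₆ := by rw [WeierstrassCurve.b₆, e3, e6]; simp
  have hb₈I : ϖ ^ 3 ∣ I.b₈ := by
    have e : I.b₈ = -(I.a₄ * I.a₄) := by rw [WeierstrassCurve.b₈, e1, e2, e3, e6]; ring
    rw [e]
    exact ((pow_dvd_pow ϖ (by norm_num : 3 ≤ 4)).trans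
      (by rw [show (4 : ℕ) = 2 + 2 by rfl, pow_add]; exact mul_dvd_mul q4 q4)).neg_right
  have h7 : distinctRootCount (cubicStep6 I) = 2 := by
    have hq : redCoeff I.a₄ 2 ≠ 0 := fun h ↦ q4n ((redCoeff_eq_zero_iff q4).mp h)
    rw [cubicStep6, redCoeff_eq_zero_of_dvd (j := 1) (by rw [e2]; exact dvd_zero _),
      redCoeff_eq_zero_of_dvd (j := 3) (by rw [e6]; exact dvd_zero _),
      distinctRootCount_cubic_eq_two_iff _ _ _ (by rw [h4res]; ring), h3res]
    simpa using hq
  -- the round-`0` model `W₇ : x ↦ x + 2`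
  set C₇ : VariableChange (v.adicCompletionIntegers ℚ) := ⟨1, 2, 0, 0⟩ with hC₇
  set W₇ := C₇ • I with hW₇
  have e71 : W₇.a₁ = 0 := by simp [hW₇, hC₇, variableChange_a₁, e1]
  have e72 : W₇.a₂ = ((2 : ℤ) ^ 1 * 3 : ℤ) := by
    simp [hW₇, hC₇, variableChange_a₂, e1, e2]; norm_num
  have e73 : W₇.a₃ = 0 := by simp [hW₇, hC₇, variableChange_a₃, e1, e3]
  have e74 : W₇.a₄ = ((1 : ℤ) : v.adicCompletionIntegers ℚ) * I.a₄ + ((12 : ℤ) : _) := by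
    simp [hW₇, hC₇, variableChange_a₄, e1, e2, e3]; ring
  have e76 : W₇.a₆ = 2 * (((1 : ℤ) : v.adicCompletionIntegers ℚ) * I.a₄ + ((4 : ℤ) : _)) := by
    simp [hW₇, hC₇, variableChange_a₆, e1, e2, e3, e6]; ring
  have s2v : Valued.v ((W₇.a₂ : v.adicCompletionIntegers ℚ) : v.adicCompletion ℚ) =
      WithZero.exp (-((1 : ℕ) : ℤ)) := by rw [e72]; exact hvalC 1 (by norm_num)
  have s2p : ϖ ^ 1 ∣ W₇.a₂ := dvd_of_le s2v.le
  have s2 : ϖ ∣ W₇.a₂ := by rwa [pow_one] at s2p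
  have s2n : ¬ ϖ ^ 2 ∣ W₇.a₂ := not_pow_succ_dvd_of_valued_eq v s2v
  have ha2 : redCoeff W₇.a₂ 1 ≠ 0 := fun h ↦ s2n ((redCoeff_eq_zero_iff s2p).mp h)
  have s1 : ϖ ∣ W₇.a₁ := by rw [e71]; exact dvd_zero _
  have s3 : ∀ k : ℕ, ϖ ^ k ∣ W₇.a₃ := fun k ↦ by rw [e73]; exact dvd_zero _
  have s4 : ϖ ^ 3 ∣ W₇.a₄ := by
    rw [e74]; exact dvd_of_le (hvalle 1 12 3 ⟨(m + 3) / 2, by omega⟩)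
  have s6 : ϖ ^ 4 ∣ W₇.a₆ := by
    rw [e76, show (4 : ℕ) = 1 + 3 by rfl, pow_add, pow_one]
    exact mul_dvd_mul ⟨ε, h2ε⟩ (dvd_of_le (hvalle 1 4 3 ⟨(m + 1) / 2, by omega⟩))
  have ha3 : redCoeff W₇.a₃ (0 + 2) = 0 := redCoeff_eq_zero_of_dvd (s3 _)
  have hA : distinctRootCount (Polynomial.X ^ 2 + Polynomial.C (redCoeff W₇.a₃ (0 + 2)) * Polynomial.X
      - Polynomial.C (redCoeff W₇.a₆ (2 * 0 + 4))) ≠ 2 := by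
    rw [Ne, testA_iff_of_two_eq_zero h2res, ha3]
    exact fun h ↦ h rfl
  -- Steps 1–7 on the models `I, I, W₇`
  have hK : I.kodairaSymbolOfMinimal = .Istar (istarIndexAux 12 0 W₇) := by
    rw [← hordΔ]
    exact kodairaSymbolOfMinimal_eq_Istar_of_models hΔI (one_smul _ I).symm
      (by rw [e3]; exact dvd_zero _) n4 (by rw [e6]; exact dvd_zero _) hb₂I
      (by rw [e6]; exact dvd_zero _) hb₈I hb₆I (one_smul _ I).symm
      (by rw [e1]; exact dvd_zero _) (by rw [e2]; exact dvd_zero _)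
      (by rw [e3]; exact dvd_zero _) q4 (by rw [e6]; exact dvd_zero _) h7 hW₇
      s1 s2 s2n (s3 2) s4 s6
  -- the `Iₙ*` sub-procedure
  have hn : istarIndexAux 12 0 W₇ = if m % 4 = 3 then 2 else 3 := by
    split_ifs with hm4
    · -- `m ≡ 3 (mod 4)`: round `0`, second quadratic has distinct roots (`W₁ = W₇`)
      have k6 : ϖ ^ (2 * 0 + 5) ∣ W₇.a₆ := by
        rw [e76, show (2 * 0 + 5 : ℕ) = 1 + 4 by rfl, pow_add, pow_one]
        exact mul_dvd_mul ⟨ε, h2ε⟩ (dvd_of_le (hvalle 1 4 4 ⟨(m + 1) / 4, by omega⟩))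
      have s4v : Valued.v ((W₇.a₄ : v.adicCompletionIntegers ℚ) : v.adicCompletion ℚ) =
          WithZero.exp (-((3 : ℕ) : ℤ)) := by
        rw [e74]; exact hval 1 12 3 (n := (m + 3) / 2) (by omega) (by omega)
      have ha4 : redCoeff W₇.a₄ (0 + 3) ≠ 0 := fun h ↦
        not_pow_succ_dvd_of_valued_eq v s4v ((redCoeff_eq_zero_iff s4).mp h)
      have hB : distinctRootCount (Polynomial.C (redCoeff W₇.a₂ 1) * Polynomial.X ^ 2
          + Polynomial.C (redCoeff W₇.a₄ (0 + 3)) * Polynomial.X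
          + Polynomial.C (redCoeff W₇.a₆ (2 * 0 + 5))) = 2 :=
        (testB_iff_of_two_eq_zero h2res ha2 _ _).mpr ha4
      have h0 : istarIndexAux (11 + 1) 0 W₇ = 2 * 0 + 2 :=
        istarIndexAux_succ_of_testB (fuel := 11) (m := 0) s1 s2 s2n (s3 _) s4 s6 hA
          (one_smul _ W₇).symm s1 s2 s2n (s3 _) s4 k6 hB
      simpa using h0
    · -- `m ≡ 1 (mod 4)`: `y ↦ y + 4`, then round `1`
      have hm1 : m % 4 = 1 := by omega
      set C₁ : VariableChange (v.adicCompletionIntegers ℚ) := ⟨1, 0, 0, 4⟩ with hC₁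
      set W₁ := C₁ • W₇ with hW₁
      have e11 : W₁.a₁ = 0 := by simp [hW₁, hC₁, variableChange_a₁, e71]
      have e12 : W₁.a₂ = W₇.a₂ := by simp [hW₁, hC₁, variableChange_a₂, e71]
      have e13 : W₁.a₃ = ((2 : ℤ) ^ 3 * 1 : ℤ) := by
        simp [hW₁, hC₁, variableChange_a₃, e71, e73]; norm_num
      have e14 : W₁.a₄ = ((1 : ℤ) : v.adicCompletionIntegers ℚ) * I.a₄ + ((12 : ℤ) : _) := by
        simp [hW₁, hC₁, variableChange_a₄, e71, e73, e74]
      have e16 : W₁.a₆ = 2 * (((1 : ℤ) : v.adicCompletionIntegers ℚ) * I.a₄ + ((-4 : ℤ) : _)) := by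
        simp [hW₁, hC₁, variableChange_a₆, e71, e73, e76]; ring
      have k1 : ϖ ∣ W₁.a₁ := by rw [e11]; exact dvd_zero _
      have k3v : Valued.v ((W₁.a₃ : v.adicCompletionIntegers ℚ) : v.adicCompletion ℚ) =
          WithZero.exp (-((3 : ℕ) : ℤ)) := by rw [e13]; exact hvalC 3 (by norm_num)
      have k3 : ϖ ^ 3 ∣ W₁.a₃ := dvd_of_le k3v.le
      have k4 : ϖ ^ 4 ∣ W₁.a₄ := by
        rw [e14]; exact dvd_of_le (hvalle 1 12 4 ⟨(m + 3) / 4, by omega⟩)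
      have k6 : ϖ ^ 5 ∣ W₁.a₆ := by
        rw [e16, show (5 : ℕ) = 1 + 4 by rfl, pow_add, pow_one]
        exact mul_dvd_mul ⟨ε, h2ε⟩ (dvd_of_le (hvalle 1 (-4) 4 ⟨(m - 1) / 4, by omega⟩))
      have k2p : ϖ ^ 1 ∣ W₁.a₂ := by rw [e12]; exact s2p
      have k2 : ϖ ∣ W₁.a₂ := by rw [e12]; exact s2
      have k2n : ¬ ϖ ^ 2 ∣ W₁.a₂ := by rw [e12]; exact s2n
      have hb2 : redCoeff W₁.a₂ 1 ≠ 0 := fun h ↦ k2n ((redCoeff_eq_zero_iff k2p).mp h)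
      have hb4 : redCoeff W₁.a₄ (0 + 3) = 0 := redCoeff_eq_zero_of_dvd k4
      have hB : distinctRootCount (Polynomial.C (redCoeff W₁.a₂ 1) * Polynomial.X ^ 2
          + Polynomial.C (redCoeff W₁.a₄ (0 + 3)) * Polynomial.X
          + Polynomial.C (redCoeff W₁.a₆ (2 * 0 + 5))) ≠ 2 := by
        rw [Ne, testB_iff_of_two_eq_zero h2res hb2, hb4]
        exact fun h ↦ h rfl
      -- the round-`1` model `W₂`
      obtain ⟨W₂, C₂, hW₂, j2, j2n, j3v, j4, j6⟩ : ∃ (W₂ : WeierstrassCurve (v.adicCompletionIntegers ℚ))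
          (C₂ : VariableChange (v.adicCompletionIntegers ℚ)), W₂ = C₂ • W₁ ∧
          ϖ ∣ W₂.a₂ ∧ ¬ ϖ ^ 2 ∣ W₂.a₂ ∧
          (W₂.a₁ = 0 ∧ Valued.v ((W₂.a₃ : v.adicCompletionIntegers ℚ) : v.adicCompletion ℚ) =
            WithZero.exp (-((3 : ℕ) : ℤ))) ∧
          ϖ ^ 4 ∣ W₂.a₄ ∧ ϖ ^ 6 ∣ W₂.a₆ := by
        by_cases hm8 : m % 8 = 1
        · refine ⟨W₁, 1, (one_smul _ _).symm, k2, k2n, ⟨e11, k3v⟩, k4, ?_⟩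
          rw [e16, show (6 : ℕ) = 1 + 5 by rfl, pow_add, pow_one]
          exact mul_dvd_mul ⟨ε, h2ε⟩ (dvd_of_le (hvalle 1 (-4) 5 ⟨(m - 1) / 8, by omega⟩))
        · have hm5 : m % 8 = 5 := by omega
          set C₂ : VariableChange (v.adicCompletionIntegers ℚ) := ⟨1, 4, 0, 0⟩ with hC₂
          have e22 : (C₂ • W₁).a₂ = ((2 : ℤ) ^ 1 * 9 : ℤ) := by
            simp [hC₂, variableChange_a₂, e11, e12, e72]; norm_num
          have hv9 : Valued.v (((C₂ • W₁).a₂ : v.adicCompletionIntegers ℚ) : v.adicCompletion ℚ) =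
              WithZero.exp (-((1 : ℕ) : ℤ)) := by rw [e22]; exact hvalC 1 (by norm_num)
          refine ⟨C₂ • W₁, C₂, rfl, ?_, not_pow_succ_dvd_of_valued_eq v hv9, ⟨?_, ?_⟩, ?_, ?_⟩
          · have := dvd_of_le hv9.le; rwa [pow_one] at this
          · simp [hC₂, variableChange_a₁, e11]
          · have e : (C₂ • W₁).a₃ = W₁.a₃ := by simp [hC₂, variableChange_a₃, e11]
            rw [e]; exact k3v
          · have e : (C₂ • W₁).a₄ = ((1 : ℤ) : v.adicCompletionIntegers ℚ) * I.a₄ + ((108 : ℤ) : _) := by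
              simp [hC₂, variableChange_a₄, e11, e12, e13, e14, e72]; ring
            rw [e]; exact dvd_of_le (hvalle 1 108 4 ⟨(m + 27) / 4, by omega⟩)
          · have e : (C₂ • W₁).a₆ = 2 * (((3 : ℤ) : v.adicCompletionIntegers ℚ) * I.a₄ + ((100 : ℤ) : _)) := by
              simp [hC₂, variableChange_a₆, e11, e12, e13, e14, e16, e72]; ring
            rw [e, show (6 : ℕ) = 1 + 5 by rfl, pow_add, pow_one]
            exact mul_dvd_mul ⟨ε, h2ε⟩ (dvd_of_le (hvalle 3 100 5 ⟨(3 * m + 25) / 8, by omega⟩))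
      have j1 : ϖ ∣ W₂.a₁ := by rw [j3v.1]; exact dvd_zero _
      have j3 : ϖ ^ 3 ∣ W₂.a₃ := dvd_of_le j3v.2.le
      have hstep : istarIndexAux (11 + 1) 0 W₇ = istarIndexAux 11 (0 + 1) W₂ :=
        istarIndexAux_succ_of_not_testB (fuel := 11) (m := 0) s1 s2 s2n (s3 _) s4 s6 hA hW₁
          k1 k2 k2n k3 ((pow_dvd_pow ϖ (by norm_num)).trans k4) k6 hB hW₂ j1 j2 j2n j3 j4 j6
      have ha3' : redCoeff W₂.a₃ (1 + 2) ≠ 0 := fun h ↦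
        not_pow_succ_dvd_of_valued_eq v j3v.2 ((redCoeff_eq_zero_iff j3).mp h)
      have hA' : distinctRootCount (Polynomial.X ^ 2 + Polynomial.C (redCoeff W₂.a₃ (1 + 2)) * Polynomial.X
          - Polynomial.C (redCoeff W₂.a₆ (2 * 1 + 4))) = 2 :=
        (testA_iff_of_two_eq_zero h2res _ _).mpr ha3'
      have hlast : istarIndexAux (10 + 1) 1 W₂ = 2 * 1 + 1 := istarIndexAux_succ_of_testA 10 1 W₂ hA'
      have h12 : istarIndexAux 12 0 W₇ = istarIndexAux 11 1 W₂ := by simpa using hstep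
      have h11 : istarIndexAux 11 1 W₂ = 3 := by simpa using hlast
      rw [h12, h11]
  -- read `kodairaSymbolAt` and `ord Δ_min` of `W` on the minimal model `X`
  have hrel : X = (C.map (algebraMap ℚ (v.adicCompletion ℚ))) • W.baseChange (v.adicCompletion ℚ) := by
    rw [hX, hM, WeierstrassCurve.baseChange, WeierstrassCurve.baseChange, map_variableChange]
  refine ⟨?_, ?_⟩
  · rw [W.kodairaSymbolAt_eq_kodairaSymbolOfMinimal_of_isMinimal v X _ hrel X.isUnit_Δ.ne_zero, ← hI,
      hK, hn]
  · rw [W.ordMinimalDiscriminant_eq_of_isMinimal v X _ hrel X.isUnit_Δ.ne_zero, ← hI, hordΔ]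

end Kodaira

/-! ### The wild exponents `δ₂ = f₂ - 2` -/

section Wild

variable {v : HeightOneSpectrum (𝓞 ℚ)} {W : WeierstrassCurve ℚ}

/-- `δ_v` from the Kodaira type and `ord_v Δ_min` (the tree's `conductorExponent` is Ogg's
formula `f = ord Δ_min + 1 - m`, and `ε = 2` at the additive types). [folklore] -/
private theorem wildConductorExponent_eq_of_eq {T : KodairaSymbol} {n : ℕ}
    (h : W.kodairaSymbolAt v = T ∧ W.ordMinimalDiscriminant v = n) :
    W.wildConductorExponent v = n + 1 - T.numComponents - T.tameConductorExponent := by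
  unfold wildConductorExponent conductorExponent numComponentsAt
  rw [h.1, h.2]

/-- **`δ₂ = 4` for `y² = x³ + ax`, `a ≡ 1 (mod 4)`** (type `II`, `ord₂ Δ_min = 6`: `f₂ = 6`;
e.g. `64a4: y² = x³ + x`). [cite: SilvermanATAEC1994, §IV.10 Definition of ε, δ, f (PDF p. 358), IV.9.4 and Table 4.1] -/
theorem wildConductorExponent_of_j1728_emod_four_eq_one [W.IsElliptic] (hv : natGenerator v = 2)
    {a : ℤ} (ha : a % 4 = 1) {C : VariableChange ℚ} (hC : C • W = ⟨0, 0, 0, (a : ℚ), 0⟩) :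
    W.wildConductorExponent v = 4 := by
  rw [wildConductorExponent_eq_of_eq
    (W.kodairaSymbolAt_and_ordMinimalDiscriminant_of_j1728_emod_four_eq_one hv ha hC)]
  rfl

/-- **`δ₂ = 3` for `y² = x³ + ax`, `a ≡ 3 (mod 4)`** (type `III`, `ord₂ Δ_min = 6`: `f₂ = 5`;
e.g. `32a2: y² = x³ - x`). [cite: SilvermanATAEC1994, §IV.10 Definition of ε, δ, f (PDF p. 358), IV.9.4 and Table 4.1] -/
theorem wildConductorExponent_of_j1728_emod_four_eq_three [W.IsElliptic] (hv : natGenerator v = 2)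
    {a : ℤ} (ha : a % 4 = 3) {C : VariableChange ℚ} (hC : C • W = ⟨0, 0, 0, (a : ℚ), 0⟩) :
    W.wildConductorExponent v = 3 := by
  rw [wildConductorExponent_eq_of_eq
    (W.kodairaSymbolAt_and_ordMinimalDiscriminant_of_j1728_emod_four_eq_three hv ha hC)]
  rfl

/-- **`δ₂ = 6` for `y² = x³ + 2mx`, `m` odd** (type `III`, `ord₂ Δ_min = 9`: `f₂ = 8`).
[cite: SilvermanATAEC1994, §IV.10 Definition of ε, δ, f (PDF p. 358), IV.9.4 and Table 4.1] -/
theorem wildConductorExponent_of_j1728_two_mul_odd [W.IsElliptic] (hv : natGenerator v = 2)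
    {m : ℤ} (hm : ¬ (2 : ℤ) ∣ m) {C : VariableChange ℚ} (hC : C • W = ⟨0, 0, 0, 2 * (m : ℚ), 0⟩) :
    W.wildConductorExponent v = 6 := by
  rw [wildConductorExponent_eq_of_eq
    (W.kodairaSymbolAt_and_ordMinimalDiscriminant_of_j1728_two_mul_odd hv hm hC)]
  rfl

/-- **`δ₂ = 6` for `y² = x³ + 8mx`, `m` odd** (type `III*`, `ord₂ Δ_min = 15`: `f₂ = 8`).
[cite: SilvermanATAEC1994, §IV.10 Definition of ε, δ, f (PDF p. 358), IV.9.4 and Table 4.1] -/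
theorem wildConductorExponent_of_j1728_eight_mul_odd [W.IsElliptic] (hv : natGenerator v = 2)
    {m : ℤ} (hm : ¬ (2 : ℤ) ∣ m) {C : VariableChange ℚ} (hC : C • W = ⟨0, 0, 0, 8 * (m : ℚ), 0⟩) :
    W.wildConductorExponent v = 6 := by
  rw [wildConductorExponent_eq_of_eq
    (W.kodairaSymbolAt_and_ordMinimalDiscriminant_of_j1728_eight_mul_odd hv hm hC)]
  rfl

/-- **`δ₂ = 4` (`m ≡ 3 (mod 4)`, type `I₂*`, `f₂ = 6`) resp. `δ₂ = 3` (`m ≡ 1 (mod 4)`, type `I₃*`,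
`f₂ = 5`) for `y² = x³ + 4mx`, `m` odd** (`ord₂ Δ_min = 12`; e.g. `64a1: y² = x³ - 4x`,
`32a1: y² = x³ + 4x`). [cite: SilvermanATAEC1994, §IV.10 Definition of ε, δ, f (PDF p. 358), IV.9.4 and Table 4.1] -/
theorem wildConductorExponent_of_j1728_four_mul_odd [W.IsElliptic] (hv : natGenerator v = 2)
    {m : ℤ} (hm : ¬ (2 : ℤ) ∣ m) {C : VariableChange ℚ} (hC : C • W = ⟨0, 0, 0, 4 * (m : ℚ), 0⟩) :
    W.wildConductorExponent v = if m % 4 = 3 then 4 else 3 := by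
  rw [wildConductorExponent_eq_of_eq
    (W.kodairaSymbolAt_and_ordMinimalDiscriminant_of_j1728_four_mul_odd hv hm hC)]
  split_ifs <;> rfl

end Wild

/-! ### Assembly: Saito's half at `2` and the C15 fact for these curves from `Sw_𝔓(E[3])` -/

section Assembly

variable (W : WeierstrassCurve ℚ) (ℓ : ℕ) [Fact ℓ.Prime]

/-- The six classes of `y² = x³ + ax` (`a ∈ ℤ`, `16 ∤ a`) with their wild exponent `δ₂` at `2`:
`a ≡ 1 (mod 4) ↦ 4`, `a ≡ 3 (mod 4) ↦ 3`, `a = 2m ↦ 6`, `a = 4m ↦ 4` (`m ≡ 3`) or `3`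
(`m ≡ 1 (mod 4)`), `a = 8m ↦ 6` (`m` odd). [cite: SilvermanATAEC1994, §IV.10 Definition of ε, δ, f (PDF p. 358), IV.9.4 and Table 4.1] -/
theorem wildConductorExponent_of_j1728_class [W.IsElliptic] {v : HeightOneSpectrum (𝓞 ℚ)}
    (hv : natGenerator v = 2) {a : ℤ} {C : VariableChange ℚ} (hC : C • W = ⟨0, 0, 0, (a : ℚ), 0⟩)
    {δ : ℕ}
    (hδ : (a % 4 = 1 ∧ δ = 4) ∨ (a % 4 = 3 ∧ δ = 3) ∨
      (∃ m : ℤ, ¬ (2 : ℤ) ∣ m ∧ a = 2 * m ∧ δ = 6) ∨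
      (∃ m : ℤ, ¬ (2 : ℤ) ∣ m ∧ m % 4 = 3 ∧ a = 4 * m ∧ δ = 4) ∨
      (∃ m : ℤ, ¬ (2 : ℤ) ∣ m ∧ m % 4 = 1 ∧ a = 4 * m ∧ δ = 3) ∨
      (∃ m : ℤ, ¬ (2 : ℤ) ∣ m ∧ a = 8 * m ∧ δ = 6)) :
    W.wildConductorExponent v = δ := by
  rcases hδ with ⟨ha, rfl⟩ | ⟨ha, rfl⟩ | ⟨m, hm, rfl, rfl⟩ | ⟨m, hm, hm4, rfl, rfl⟩ |
      ⟨m, hm, hm4, rfl, rfl⟩ | ⟨m, hm, rfl, rfl⟩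
  · exact wildConductorExponent_of_j1728_emod_four_eq_one hv ha hC
  · exact wildConductorExponent_of_j1728_emod_four_eq_three hv ha hC
  · exact wildConductorExponent_of_j1728_two_mul_odd hv hm (by simpa using hC)
  · rw [wildConductorExponent_of_j1728_four_mul_odd hv hm (by simpa using hC), if_pos hm4]
  · rw [wildConductorExponent_of_j1728_four_mul_odd hv hm (by simpa using hC), if_neg (by omega)]
  · exact wildConductorExponent_of_j1728_eight_mul_odd hv hm (by simpa using hC)

/-- **Every elliptic curve over `ℚ` with `j = 1728` falls in one of the six classes**, with the
corresponding value of `δ₂`: by `exists_variableChange_eq_of_j_eq_1728`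
(`ComplexMultiplicationDeuringRamified1728Proofs`; Silverman *AEC* X.5.4) `C • W = ⟨0, 0, 0, a, 0⟩`
with `a = 2^r a₀`, `a₀` odd, `r < 4`.  So Saito's half of Ogg's formula at `2` for the curves
with `j = 1728` is exactly the statement `Sw_𝔓(E_a[3]) = δ(a)` for the six classes
(`swanConductorAt_rationalTate_eq_wildConductorExponent_of_ringChar_eq_two_of_j1728_model`).
[cite: SilvermanAEC2009, X.5.4] [cite: SilvermanATAEC1994, IV.9.4 and Table 4.1, §IV.10 (PDF p. 358)] -/
theorem exists_j1728_model_wildConductorExponent [W.IsElliptic] {v : HeightOneSpectrum (𝓞 ℚ)}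
    (hv : natGenerator v = 2) (hj : W.j = 1728) :
    ∃ (a : ℤ) (C : VariableChange ℚ) (δ : ℕ), C • W = ⟨0, 0, 0, (a : ℚ), 0⟩ ∧
      W.wildConductorExponent v = δ ∧
      ((a % 4 = 1 ∧ δ = 4) ∨ (a % 4 = 3 ∧ δ = 3) ∨
        (∃ m : ℤ, ¬ (2 : ℤ) ∣ m ∧ a = 2 * m ∧ δ = 6) ∨
        (∃ m : ℤ, ¬ (2 : ℤ) ∣ m ∧ m % 4 = 3 ∧ a = 4 * m ∧ δ = 4) ∨
        (∃ m : ℤ, ¬ (2 : ℤ) ∣ m ∧ m % 4 = 1 ∧ a = 4 * m ∧ δ = 3) ∨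
        (∃ m : ℤ, ¬ (2 : ℤ) ∣ m ∧ a = 8 * m ∧ δ = 6)) := by
  obtain ⟨r, A₀, C, hr, hA₀, hC⟩ := exists_variableChange_eq_of_j_eq_1728 W hj
  have hA₀' : ¬ (2 : ℤ) ∣ A₀ := fun h ↦ Int.not_even_iff_odd.mpr hA₀ (even_iff_two_dvd.mpr h)
  have hC' : C • W = ⟨0, 0, 0, ((2 ^ r * A₀ : ℤ) : ℚ), 0⟩ := by rw [hC]; push_cast; rfl
  have key : ∀ {δ : ℕ},
      ((2 ^ r * A₀) % 4 = 1 ∧ δ = 4) ∨ ((2 ^ r * A₀) % 4 = 3 ∧ δ = 3) ∨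
        (∃ m : ℤ, ¬ (2 : ℤ) ∣ m ∧ 2 ^ r * A₀ = 2 * m ∧ δ = 6) ∨
        (∃ m : ℤ, ¬ (2 : ℤ) ∣ m ∧ m % 4 = 3 ∧ 2 ^ r * A₀ = 4 * m ∧ δ = 4) ∨
        (∃ m : ℤ, ¬ (2 : ℤ) ∣ m ∧ m % 4 = 1 ∧ 2 ^ r * A₀ = 4 * m ∧ δ = 3) ∨
        (∃ m : ℤ, ¬ (2 : ℤ) ∣ m ∧ 2 ^ r * A₀ = 8 * m ∧ δ = 6) →
      ∃ (a : ℤ) (C : VariableChange ℚ) (δ : ℕ), C • W = ⟨0, 0, 0, (a : ℚ), 0⟩ ∧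
        W.wildConductorExponent v = δ ∧
        ((a % 4 = 1 ∧ δ = 4) ∨ (a % 4 = 3 ∧ δ = 3) ∨
          (∃ m : ℤ, ¬ (2 : ℤ) ∣ m ∧ a = 2 * m ∧ δ = 6) ∨
          (∃ m : ℤ, ¬ (2 : ℤ) ∣ m ∧ m % 4 = 3 ∧ a = 4 * m ∧ δ = 4) ∨
          (∃ m : ℤ, ¬ (2 : ℤ) ∣ m ∧ m % 4 = 1 ∧ a = 4 * m ∧ δ = 3) ∨
          (∃ m : ℤ, ¬ (2 : ℤ) ∣ m ∧ a = 8 * m ∧ δ = 6)) :=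
    fun hδ ↦ ⟨_, C, _, hC', W.wildConductorExponent_of_j1728_class hv hC' hδ, hδ⟩
  interval_cases r
  · rcases Int.emod_two_eq_zero_or_one A₀ with h | h
    · exact absurd (Int.dvd_of_emod_eq_zero h) hA₀'
    · have h4 : A₀ % 4 = 1 ∨ A₀ % 4 = 3 := by omega
      rcases h4 with h4 | h4
      · exact key (δ := 4) (Or.inl ⟨by simpa using h4, rfl⟩)
      · exact key (δ := 3) (Or.inr (Or.inl ⟨by simpa using h4, rfl⟩))
  · exact key (δ := 6) (Or.inr (Or.inr (Or.inl ⟨A₀, hA₀', by ring, rfl⟩)))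
  · have h4 : A₀ % 4 = 1 ∨ A₀ % 4 = 3 := by omega
    rcases h4 with h4 | h4
    · exact key (δ := 3) (Or.inr (Or.inr (Or.inr (Or.inr (Or.inl ⟨A₀, hA₀', h4, by ring, rfl⟩)))))
    · exact key (δ := 4) (Or.inr (Or.inr (Or.inr (Or.inl ⟨A₀, hA₀', h4, by ring, rfl⟩))))
  · exact key (δ := 6) (Or.inr (Or.inr (Or.inr (Or.inr (Or.inr ⟨A₀, hA₀', by ring, rfl⟩)))))

attribute [local instance] AddSubgroup.torsionBy.zmodModule in
/-- **Saito's half of Ogg's formula at `2`, every `ℓ`, for `y² = x³ + ax`, from the break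
computation `Sw_𝔓(E[3]) = δ₂`.**  Let `W/ℚ` with `C • W = ⟨0, 0, 0, a, 0⟩`, `a` in one of the six
classes `a ≡ 1, 3 (mod 4)`, `a = 2m`, `a = 4m` (`m ≡ 3`, resp. `1 (mod 4)`), `a = 8m` (`m` odd)
with `δ = 4, 3, 6, 4, 3, 6`.  If (for `W` elliptic) `Sw_𝔓(E[3]) = δ` for some prime `𝔓` of
`\bar ℤ` above `2`, then the named fact
`swanConductorAt_rationalTate_eq_wildConductorExponent_of_ringChar_eq_two W ℓ` holds for every
prime `ℓ`: this file supplies `δ₂(W) = δ` (Tate's algorithm), and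
`…_of_valuation_j_lt_one` (`OggFormulaPotGoodOrdinaryTwoProofs`) transports the hypothesis to
every `𝔓 ∣ 2` and to `V_ℓ`.  (For the Galois side see the module docstring: `Gal(ℚ₂^{nr}(E[3])/ℚ₂^{nr}) ≅ Q₈`,
`Sw = 2u_L`, `u_L = δ/2`.)
[cite: SilvermanATAEC1994, Thm. IV.11.1 case p = 2 (PDF pp. 365–366), §IV.10 (p. 358)]
[cite: SerreTate1968, §3] [cite: Saito1988, Theorem 1] -/
theorem swanConductorAt_rationalTate_eq_wildConductorExponent_of_ringChar_eq_two_of_j1728_model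
    {a : ℤ} {C : VariableChange ℚ} (hC : C • W = ⟨0, 0, 0, (a : ℚ), 0⟩) {δ : ℕ}
    (hδ : (a % 4 = 1 ∧ δ = 4) ∨ (a % 4 = 3 ∧ δ = 3) ∨
      (∃ m : ℤ, ¬ (2 : ℤ) ∣ m ∧ a = 2 * m ∧ δ = 6) ∨
      (∃ m : ℤ, ¬ (2 : ℤ) ∣ m ∧ m % 4 = 3 ∧ a = 4 * m ∧ δ = 4) ∨
      (∃ m : ℤ, ¬ (2 : ℤ) ∣ m ∧ m % 4 = 1 ∧ a = 4 * m ∧ δ = 3) ∨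
      (∃ m : ℤ, ¬ (2 : ℤ) ∣ m ∧ a = 8 * m ∧ δ = 6))
    (hG : ∀ [W.IsElliptic],
      ∃ 𝔓 ∈ ((Rat.HeightOneSpectrum.primesEquiv (R := 𝓞 ℚ)).symm ⟨2, Nat.prime_two⟩).primesAbove,
        (W.torsionGaloisRep 3).swanConductorAt (𝓞 ℚ) 𝔓 = (δ : ℝ)) :
    W.swanConductorAt_rationalTate_eq_wildConductorExponent_of_ringChar_eq_two ℓ := by
  have hv : natGenerator ((Rat.HeightOneSpectrum.primesEquiv (R := 𝓞 ℚ)).symm ⟨2, Nat.prime_two⟩) = 2 :=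
    congrArg Subtype.val ((Rat.HeightOneSpectrum.primesEquiv (R := 𝓞 ℚ)).apply_symm_apply ⟨2, Nat.prime_two⟩)
  apply W.swanConductorAt_rationalTate_eq_wildConductorExponent_of_ringChar_eq_two_of_valuation_j_lt_one ℓ
  intro _ _ _
  obtain ⟨𝔓, h𝔓, hSw⟩ := hG
  exact ⟨𝔓, h𝔓, by rw [hSw, W.wildConductorExponent_of_j1728_class hv hC hδ]⟩

attribute [local instance] AddSubgroup.torsionBy.zmodModule in
/-- **The C15 fact `N^{(ℓ)}(V_ℓ E) = N_E`, every `ℓ`, for `y² = x³ + ax` in the six classes, from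
`Sw_𝔓(E[3]) = δ₂`** (`conductorNatOf_geomPoints_eq_conductorNorm_of_isElliptic_of_two`,
`HasseWeilAbelianConductorSaitoLeafProofs`, on top of the previous theorem).
[cite: SerreTate1968, §3] [cite: SilvermanATAEC1994, §IV.10 Definition of the conductor (PDF p. 364), Thm. IV.11.1 (pp. 365–366)]
[cite: Saito1988, Theorem 1] -/
theorem conductorNatOf_geomPoints_eq_conductorNorm_of_isElliptic_of_j1728_model
    {a : ℤ} {C : VariableChange ℚ} (hC : C • W = ⟨0, 0, 0, (a : ℚ), 0⟩) {δ : ℕ}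
    (hδ : (a % 4 = 1 ∧ δ = 4) ∨ (a % 4 = 3 ∧ δ = 3) ∨
      (∃ m : ℤ, ¬ (2 : ℤ) ∣ m ∧ a = 2 * m ∧ δ = 6) ∨
      (∃ m : ℤ, ¬ (2 : ℤ) ∣ m ∧ m % 4 = 3 ∧ a = 4 * m ∧ δ = 4) ∨
      (∃ m : ℤ, ¬ (2 : ℤ) ∣ m ∧ m % 4 = 1 ∧ a = 4 * m ∧ δ = 3) ∨
      (∃ m : ℤ, ¬ (2 : ℤ) ∣ m ∧ a = 8 * m ∧ δ = 6))
    (hG : ∀ [W.IsElliptic],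
      ∃ 𝔓 ∈ ((Rat.HeightOneSpectrum.primesEquiv (R := 𝓞 ℚ)).symm ⟨2, Nat.prime_two⟩).primesAbove,
        (W.torsionGaloisRep 3).swanConductorAt (𝓞 ℚ) 𝔓 = (δ : ℝ)) :
    W.conductorNatOf_geomPoints_eq_conductorNorm_of_isElliptic ℓ :=
  W.conductorNatOf_geomPoints_eq_conductorNorm_of_isElliptic_of_two ℓ
    (W.swanConductorAt_rationalTate_eq_wildConductorExponent_of_ringChar_eq_two_of_j1728_model ℓ hC
      hδ hG)

end Assembly

end WeierstrassCurve
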